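import Mathlib
import Summits.Ventures.PercRepro2.Defs
import Summits.Ventures.PercRepro2.BoxUnionDefs
import Summits.Ventures.PercRepro2.BoxUnionCubeLemmas

/-!
# The shape theorem on the cube — the combinatorial core
(blind cell PercRepro2, mine-1 g37; paper proof proofs/MINE1-BOXUNION-SHAPE.md, part B)

On the configuration cube `Config E = E → Bool`, a *bad 2-face trace* of `U` is one of the five
patterns `{d}`, `{d'}`, `{d, d'}`, `{m, d, d'}`, `{d, d', s}` on a square
`{x, x[i↦1], x[j↦1], x[i↦1][j↦1]}` (`x i = x j = false`, `i ≠ j`).  This file proves, purely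
combinatorially, that a set `U` WITHOUT bad 2-face traces (hypotheses `T1`, `T3`, `T4`, `T5`
below, the traces `{d}`, `{d, d'}`, `{m, d, d'}`, `{d, d', s}`) is `∅`, a principal down-set, a
principal up-set or a box union `↓a ∪ ↑b` (`boxUnion_of_no_bad_face`):

* `conv_of_no_bad_face` — the complement of `U` is order-convex (no `x < y < z` with
  `x, z ∉ U`, `y ∈ U`), by strong induction on the number of coordinates where `x` and `z`
  differ: the neighbours `x[e↦1]`, `z[e↦0]` of a minimal bad triple lie in `U`, and either the
  triple lives on a single 2-face or a second coordinate produces the trace `{d, d', s}` at the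
  bottom or `{m, d, d'}` at the top;
* `sup_mem_of_no_bad_face` — two principal down-sets inside `U` have their join in `U`, by strong
  induction on the number of differing coordinates (removing one coordinate from either side lands
  on a 2-face with trace `{m, d, d'}` or contradicts convexity); `inf_mem_of_no_bad_face` dually;
* the assembly: `U = D ∪ V` with `D` the largest down-set and `V` the largest up-set inside `U`,
  both principal (`Finset.sup'_mem` / `Finset.inf'_mem`).
-/

namespace Summit.Ventures.PercRepro2

open Finset BoxUnion

open scoped Classical

section Core

variable {E : Type*} [Fintype E] [DecidableEq E]

/-- **Order-convexity of the complement.** Without the bad traces `{d}`, `{d, d'}`, `{m, d, d'}`,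
`{d, d', s}` on 2-faces there is no `x < y < z` with `x, z ∉ U` and `y ∈ U`. -/
theorem conv_of_no_bad_face (U : Set (Config E))
    (T1 : ∀ (x : Config E) (i j : E), i ≠ j → x i = false → x j = false → x ∉ U →
      Function.update x i true ∈ U → Function.update x j true ∉ U →
      Function.update (Function.update x i true) j true ∉ U → False)
    (T3 : ∀ (x : Config E) (i j : E), i ≠ j → x i = false → x j = false → x ∉ U →
      Function.update x i true ∈ U → Function.update x j true ∈ U →
      Function.update (Function.update x i true) j true ∉ U → False)
    (T4 : ∀ (x : Config E) (i j : E), i ≠ j → x i = false → x j = false → x ∈ U →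
      Function.update x i true ∈ U → Function.update x j true ∈ U →
      Function.update (Function.update x i true) j true ∉ U → False)
    (T5 : ∀ (x : Config E) (i j : E), i ≠ j → x i = false → x j = false → x ∉ U →
      Function.update x i true ∈ U → Function.update x j true ∈ U →
      Function.update (Function.update x i true) j true ∈ U → False) :
    ∀ x y z : Config E, x < y → y < z → x ∉ U → y ∈ U → z ∉ U → False := by
  suffices h : ∀ n : ℕ, ∀ x y z : Config E, (univ.filter fun e => x e ≠ z e).card = n →
      x < y → y < z → x ∉ U → y ∈ U → z ∉ U → False from fun x y z => h _ x y z rfl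
  intro n
  refine Nat.strong_induction_on n fun n ih => ?_
  intro x y z hn hxy hyz hx hy hz
  obtain ⟨e₁, hxe₁, hye₁⟩ := exists_coord_of_lt hxy
  have hze₁ : z e₁ = true := eq_true_of_true_le (hye₁ ▸ hyz.le e₁)
  obtain ⟨e₂, hye₂, hze₂⟩ := exists_coord_of_lt hyz
  have hxe₂ : x e₂ = false := eq_false_of_le_false (hye₂ ▸ hxy.le e₂)
  have h12 : e₁ ≠ e₂ := fun h => by
    rw [h, hye₂] at hye₁
    exact Bool.false_ne_true hye₁
  have hx₁U : Function.update x e₁ true ∈ U := by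
    by_contra hcon
    have hlt : Function.update x e₁ true < y :=
      lt_of_le_of_ne (update_true_le hxy.le hye₁) (fun h => hcon (h ▸ hy))
    exact ih _ (hn ▸ card_diff_update_lt (by rw [hxe₁, hze₁]; exact Bool.false_ne_true)
      hze₁.symm) (Function.update x e₁ true) y z rfl hlt hyz hcon hy hz
  have hz₁U : Function.update z e₂ false ∈ U := by
    by_contra hcon
    have hlt : y < Function.update z e₂ false :=
      lt_of_le_of_ne (le_update_false hyz.le hye₂) (fun h => hcon (h ▸ hy))
    exact ih _ (hn ▸ card_diff_update_right_lt (by rw [hxe₂, hze₂]; exact Bool.false_ne_true)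
      hxe₂.symm) x y (Function.update z e₂ false) rfl hxy hlt hx hy hcon
  by_cases hy1 : y = Function.update x e₁ true
  · by_cases hz1 : z = Function.update (Function.update x e₁ true) e₂ true
    · -- the whole triple lives on the face at `x` spanned by `e₁, e₂`
      by_cases hx2 : Function.update x e₂ true ∈ U
      · exact T3 x e₁ e₂ h12 hxe₁ hxe₂ hx (hy1 ▸ hy) hx2 (hz1 ▸ hz)
      · exact T1 x e₁ e₂ h12 hxe₁ hxe₂ hx (hy1 ▸ hy) hx2 (hz1 ▸ hz)
    · -- a second coordinate `e₂'` of `z ∖ y`: the face at `z[e₂↦0][e₂'↦0]` minus its top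
      have hyz₁ : y < Function.update z e₂ false := by
        refine lt_of_le_of_ne (le_update_false hyz.le hye₂) fun h => hz1 ?_
        calc z = Function.update z e₂ true := (Function.update_eq_self_iff.mpr hze₂.symm).symm
          _ = Function.update (Function.update z e₂ false) e₂ true :=
              (Function.update_idem _ _ _).symm
          _ = Function.update y e₂ true := by rw [← h]
          _ = Function.update (Function.update x e₁ true) e₂ true := by rw [hy1]
      obtain ⟨e₂', hye₂', hz₁e₂'⟩ := exists_coord_of_lt hyz₁
      have h22 : e₂' ≠ e₂ := fun h => by subst h; simp at hz₁e₂'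
      have hze₂' : z e₂' = true := by rwa [Function.update_of_ne h22] at hz₁e₂'
      have hxe₂' : x e₂' = false := eq_false_of_le_false (hye₂' ▸ hxy.le e₂')
      have hz₂U : Function.update z e₂' false ∈ U := by
        by_contra hcon
        have hlt : y < Function.update z e₂' false :=
          lt_of_le_of_ne (le_update_false hyz.le hye₂') (fun h => hcon (h ▸ hy))
        exact ih _ (hn ▸ card_diff_update_right_lt
          (by rw [hxe₂', hze₂']; exact Bool.false_ne_true) hxe₂'.symm) x y
          (Function.update z e₂' false) rfl hxy hlt hx hy hcon
      have hwU : Function.update (Function.update z e₂ false) e₂' false ∈ U := by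
        by_contra hcon
        have hlt : y < Function.update (Function.update z e₂ false) e₂' false :=
          lt_of_le_of_ne (le_update_false hyz₁.le hye₂') (fun h => hcon (h ▸ hy))
        refine ih _ ?_ x y (Function.update (Function.update z e₂ false) e₂' false) rfl hxy hlt
          hx hy hcon
        rw [← hn]
        exact lt_trans (card_diff_update_right_lt (x := x) (z := Function.update z e₂ false)
          (by rw [hxe₂', hz₁e₂']; exact Bool.false_ne_true) hxe₂'.symm)
          (card_diff_update_right_lt (by rw [hxe₂, hze₂]; exact Bool.false_ne_true) hxe₂.symm)
      have hzt₂ : Function.update z e₂ true = z := Function.update_eq_self_iff.mpr hze₂.symm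
      have hzt₂' : Function.update z e₂' true = z := Function.update_eq_self_iff.mpr hze₂'.symm
      have hwa : Function.update (Function.update z e₂ false) e₂' false e₂ = false := by
        rw [Function.update_of_ne h22.symm]; simp
      have hwb : Function.update (Function.update z e₂ false) e₂' false e₂' = false := by simp
      have hw1 : Function.update (Function.update (Function.update z e₂ false) e₂' false) e₂ true
          = Function.update z e₂' false := by
        rw [Function.update_comm h22.symm, Function.update_idem, Function.update_comm h22, hzt₂]
      have hw2 : Function.update (Function.update (Function.update z e₂ false) e₂' false) e₂' true
          = Function.update z e₂ false := by
        rw [Function.update_idem, Function.update_comm h22.symm, hzt₂']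
      have hw3 : Function.update (Function.update (Function.update (Function.update z e₂ false)
          e₂' false) e₂ true) e₂' true = z := by
        rw [hw1, Function.update_idem, hzt₂']
      exact T4 _ e₂ e₂' h22.symm hwa hwb hwU (by rw [hw1]; exact hz₂U) (by rw [hw2]; exact hz₁U)
        (by rw [hw3]; exact hz)
  · -- a second coordinate `e₁'` of `y ∖ x`: the face at `x` minus its bottom
    have hx₁y : Function.update x e₁ true < y :=
      lt_of_le_of_ne (update_true_le hxy.le hye₁) (fun h => hy1 h.symm)
    obtain ⟨e₁', hx₁e₁', hye₁'⟩ := exists_coord_of_lt hx₁y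
    have h11 : e₁' ≠ e₁ := fun h => by subst h; simp at hx₁e₁'
    have hxe₁' : x e₁' = false := by rwa [Function.update_of_ne h11] at hx₁e₁'
    have hze₁' : z e₁' = true := eq_true_of_true_le (hye₁' ▸ hyz.le e₁')
    have hx₂U : Function.update x e₁' true ∈ U := by
      by_contra hcon
      have hlt : Function.update x e₁' true < y :=
        lt_of_le_of_ne (update_true_le hxy.le hye₁') (fun h => hcon (h ▸ hy))
      exact ih _ (hn ▸ card_diff_update_lt (by rw [hxe₁', hze₁']; exact Bool.false_ne_true)
        hze₁'.symm) (Function.update x e₁' true) y z rfl hlt hyz hcon hy hz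
    have hvU : Function.update (Function.update x e₁ true) e₁' true ∈ U := by
      by_contra hcon
      have hlt : Function.update (Function.update x e₁ true) e₁' true < y :=
        lt_of_le_of_ne (update_true_le hx₁y.le hye₁') (fun h => hcon (h ▸ hy))
      refine ih _ ?_ (Function.update (Function.update x e₁ true) e₁' true) y z rfl hlt hyz hcon
        hy hz
      rw [← hn]
      exact lt_trans (card_diff_update_lt (x := Function.update x e₁ true)
        (by rw [hx₁e₁', hze₁']; exact Bool.false_ne_true) hze₁'.symm)
        (card_diff_update_lt (by rw [hxe₁, hze₁]; exact Bool.false_ne_true) hze₁.symm)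
    exact T5 x e₁ e₁' h11.symm hxe₁ hxe₁' hx hx₁U hx₂U hvU

/-- **Joins.** Without the trace `{m, d, d'}` on 2-faces and with an order-convex complement, two
principal down-sets inside `U` have their join in `U`. -/
theorem sup_mem_of_no_bad_face (U : Set (Config E))
    (T4 : ∀ (x : Config E) (i j : E), i ≠ j → x i = false → x j = false → x ∈ U →
      Function.update x i true ∈ U → Function.update x j true ∈ U →
      Function.update (Function.update x i true) j true ∉ U → False)
    (conv : ∀ x y z : Config E, x < y → y < z → x ∉ U → y ∈ U → z ∉ U → False) :
    ∀ d d' : Config E, Set.Iic d ⊆ U → Set.Iic d' ⊆ U → d ⊔ d' ∈ U := by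
  suffices h : ∀ n : ℕ, ∀ d d' : Config E, (univ.filter fun e => d e ≠ d' e).card = n →
      Set.Iic d ⊆ U → Set.Iic d' ⊆ U → d ⊔ d' ∈ U from fun d d' => h _ d d' rfl
  intro n
  refine Nat.strong_induction_on n fun n ih => ?_
  intro d d' hn hd hd'
  by_cases hdd' : d ≤ d'
  · rw [sup_eq_right.mpr hdd']; exact hd' (Set.mem_Iic.mpr le_rfl)
  by_cases hd'd : d' ≤ d
  · rw [sup_eq_left.mpr hd'd]; exact hd (Set.mem_Iic.mpr le_rfl)
  obtain ⟨a, hda, hd'a⟩ := exists_coord_of_not_le hdd'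
  obtain ⟨b, hd'b, hdb⟩ := exists_coord_of_not_le hd'd
  have hab : a ≠ b := fun h => by
    rw [← h, hda] at hdb
    exact Bool.noConfusion hdb
  have hsa : (d ⊔ d') a = true := by simp [Pi.sup_apply, hda]
  have hsb : (d ⊔ d') b = true := by simp [Pi.sup_apply, hd'b]
  -- `d[a↦0] ⊔ d' = (d ⊔ d')[a↦0] ∈ U` by the induction hypothesis
  have h1 : Function.update (d ⊔ d') a false ∈ U := by
    have hD : Set.Iic (Function.update d a false) ⊆ U := fun t ht =>
      hd (Set.mem_Iic.mpr ((Set.mem_Iic.mp ht).trans (update_false_lt hda).le))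
    have key := ih _ (hn ▸ card_diff_update_lt (by rw [hda, hd'a]; exact Bool.noConfusion)
      hd'a.symm) (Function.update d a false) d' rfl hD hd'
    convert key using 1
    funext e
    by_cases he : e = a
    · subst he; simp [Pi.sup_apply, hd'a]
    · simp [Pi.sup_apply, Function.update_of_ne he]
  have h2 : Function.update (d ⊔ d') b false ∈ U := by
    have hD : Set.Iic (Function.update d' b false) ⊆ U := fun t ht =>
      hd' (Set.mem_Iic.mpr ((Set.mem_Iic.mp ht).trans (update_false_lt hd'b).le))
    have key := ih _ (hn ▸ card_diff_update_right_lt (by rw [hdb, hd'b]; exact Bool.noConfusion)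
      hdb.symm) d (Function.update d' b false) rfl hd hD
    convert key using 1
    funext e
    by_cases he : e = b
    · subst he; simp [Pi.sup_apply, hdb]
    · simp [Pi.sup_apply, Function.update_of_ne he]
  -- the face at `(d ⊔ d')[a↦0][b↦0]` spanned by `a, b`
  by_contra hsU
  have hsta : Function.update (d ⊔ d') a true = d ⊔ d' := Function.update_eq_self_iff.mpr hsa.symm
  have hstb : Function.update (d ⊔ d') b true = d ⊔ d' := Function.update_eq_self_iff.mpr hsb.symm
  have hwa : Function.update (Function.update (d ⊔ d') a false) b false a = false := by
    rw [Function.update_of_ne hab]; simp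
  have hwb : Function.update (Function.update (d ⊔ d') a false) b false b = false := by simp
  have hw1 : Function.update (Function.update (Function.update (d ⊔ d') a false) b false) a true
      = Function.update (d ⊔ d') b false := by
    rw [Function.update_comm hab, Function.update_idem, Function.update_comm hab.symm, hsta]
  have hw2 : Function.update (Function.update (Function.update (d ⊔ d') a false) b false) b true
      = Function.update (d ⊔ d') a false := by
    rw [Function.update_idem, Function.update_comm hab, hstb]
  have hw3 : Function.update (Function.update (Function.update (Function.update (d ⊔ d') a false)
      b false) a true) b true = d ⊔ d' := by
    rw [hw1, Function.update_idem, hstb]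
  by_cases hwU : Function.update (Function.update (d ⊔ d') a false) b false ∈ U
  · exact T4 _ a b hab hwa hwb hwU (by rw [hw1]; exact h2) (by rw [hw2]; exact h1)
      (by rw [hw3]; exact hsU)
  · have hlt1 : Function.update (Function.update (d ⊔ d') a false) b false <
        Function.update (d ⊔ d') a false :=
      update_false_lt (by rw [Function.update_of_ne hab.symm]; exact hsb)
    exact conv _ _ _ hlt1 (update_false_lt hsa) hwU h1 hsU

/-- **Meets.** Without the trace `{d, d', s}` on 2-faces and with an order-convex complement, two
principal up-sets inside `U` have their meet in `U`. -/
theorem inf_mem_of_no_bad_face (U : Set (Config E))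
    (T5 : ∀ (x : Config E) (i j : E), i ≠ j → x i = false → x j = false → x ∉ U →
      Function.update x i true ∈ U → Function.update x j true ∈ U →
      Function.update (Function.update x i true) j true ∈ U → False)
    (conv : ∀ x y z : Config E, x < y → y < z → x ∉ U → y ∈ U → z ∉ U → False) :
    ∀ v v' : Config E, Set.Ici v ⊆ U → Set.Ici v' ⊆ U → v ⊓ v' ∈ U := by
  suffices h : ∀ n : ℕ, ∀ v v' : Config E, (univ.filter fun e => v e ≠ v' e).card = n →
      Set.Ici v ⊆ U → Set.Ici v' ⊆ U → v ⊓ v' ∈ U from fun v v' => h _ v v' rfl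
  intro n
  refine Nat.strong_induction_on n fun n ih => ?_
  intro v v' hn hv hv'
  by_cases hvv' : v ≤ v'
  · rw [inf_eq_left.mpr hvv']; exact hv (Set.mem_Ici.mpr le_rfl)
  by_cases hv'v : v' ≤ v
  · rw [inf_eq_right.mpr hv'v]; exact hv' (Set.mem_Ici.mpr le_rfl)
  obtain ⟨a, hva, hv'a⟩ := exists_coord_of_not_le hvv'
  obtain ⟨b, hv'b, hvb⟩ := exists_coord_of_not_le hv'v
  have hab : a ≠ b := fun h => by
    rw [← h, hva] at hvb
    exact Bool.noConfusion hvb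
  have hma : (v ⊓ v') a = false := by simp [Pi.inf_apply, hv'a]
  have hmb : (v ⊓ v') b = false := by simp [Pi.inf_apply, hvb]
  -- `v ⊓ v'[a↦1] = (v ⊓ v')[a↦1] ∈ U` by the induction hypothesis
  have h1 : Function.update (v ⊓ v') a true ∈ U := by
    have hV : Set.Ici (Function.update v' a true) ⊆ U := fun t ht =>
      hv' (Set.mem_Ici.mpr ((lt_update_true hv'a).le.trans (Set.mem_Ici.mp ht)))
    have key := ih _ (hn ▸ card_diff_update_right_lt (by rw [hva, hv'a]; exact Bool.noConfusion)
      hva.symm) v (Function.update v' a true) rfl hv hV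
    convert key using 1
    funext e
    by_cases he : e = a
    · subst he; simp [Pi.inf_apply, hva]
    · simp [Pi.inf_apply, Function.update_of_ne he]
  have h2 : Function.update (v ⊓ v') b true ∈ U := by
    have hV : Set.Ici (Function.update v b true) ⊆ U := fun t ht =>
      hv (Set.mem_Ici.mpr ((lt_update_true hvb).le.trans (Set.mem_Ici.mp ht)))
    have key := ih _ (hn ▸ card_diff_update_lt (by rw [hvb, hv'b]; exact Bool.noConfusion)
      hv'b.symm) (Function.update v b true) v' rfl hV hv'
    convert key using 1
    funext e
    by_cases he : e = b
    · subst he; simp [Pi.inf_apply, hv'b]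
    · simp [Pi.inf_apply, Function.update_of_ne he]
  -- the face at `v ⊓ v'` spanned by `a, b`
  by_contra hmU
  by_cases htU : Function.update (Function.update (v ⊓ v') a true) b true ∈ U
  · exact T5 _ a b hab hma hmb hmU h1 h2 htU
  · have hlt2 : Function.update (v ⊓ v') a true <
        Function.update (Function.update (v ⊓ v') a true) b true :=
      lt_update_true (by rw [Function.update_of_ne hab.symm]; exact hmb)
    exact conv _ _ _ (lt_update_true hma) hlt2 hmU h1 htU

/-- **The combinatorial shape theorem on the cube.** A set without bad 2-face traces is `∅`, a
principal down-set, a principal up-set or a box union. -/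
theorem boxUnion_of_no_bad_face (U : Set (Config E))
    (T1 : ∀ (x : Config E) (i j : E), i ≠ j → x i = false → x j = false → x ∉ U →
      Function.update x i true ∈ U → Function.update x j true ∉ U →
      Function.update (Function.update x i true) j true ∉ U → False)
    (T3 : ∀ (x : Config E) (i j : E), i ≠ j → x i = false → x j = false → x ∉ U →
      Function.update x i true ∈ U → Function.update x j true ∈ U →
      Function.update (Function.update x i true) j true ∉ U → False)
    (T4 : ∀ (x : Config E) (i j : E), i ≠ j → x i = false → x j = false → x ∈ U →
      Function.update x i true ∈ U → Function.update x j true ∈ U →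
      Function.update (Function.update x i true) j true ∉ U → False)
    (T5 : ∀ (x : Config E) (i j : E), i ≠ j → x i = false → x j = false → x ∉ U →
      Function.update x i true ∈ U → Function.update x j true ∈ U →
      Function.update (Function.update x i true) j true ∈ U → False) :
    U = ∅ ∨ (∃ a, U = Set.Iic a) ∨ (∃ b, U = Set.Ici b) ∨ ∃ a b, U = boxUnion a b := by
  have conv := conv_of_no_bad_face U T1 T3 T4 T5
  have hsup := sup_mem_of_no_bad_face U T4 conv
  have hinf := inf_mem_of_no_bad_face U T5 conv
  set D : Set (Config E) := {x | Set.Iic x ⊆ U} with hDdef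
  set V : Set (Config E) := {x | Set.Ici x ⊆ U} with hVdef
  have hDU : D ⊆ U := fun x hx => hx (Set.mem_Iic.mpr le_rfl)
  have hVU : V ⊆ U := fun x hx => hx (Set.mem_Ici.mpr le_rfl)
  have hDdown : ∀ x ∈ D, ∀ y, y ≤ x → y ∈ D := fun x hx y hyx t ht =>
    hx (Set.mem_Iic.mpr ((Set.mem_Iic.mp ht).trans hyx))
  have hVup : ∀ x ∈ V, ∀ y, x ≤ y → y ∈ V := fun x hx y hxy t ht =>
    hx (Set.mem_Ici.mpr (hxy.trans (Set.mem_Ici.mp ht)))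
  have hUDV : U = D ∪ V := by
    ext x
    constructor
    · intro hx
      by_contra hcon
      simp only [Set.mem_union, not_or] at hcon
      obtain ⟨y, hyx, hyU⟩ : ∃ y, y ≤ x ∧ y ∉ U := by
        by_contra h
        exact hcon.1 (fun y hy => by_contra fun hyU => h ⟨y, Set.mem_Iic.mp hy, hyU⟩)
      obtain ⟨z, hxz, hzU⟩ : ∃ z, x ≤ z ∧ z ∉ U := by
        by_contra h
        exact hcon.2 (fun z hz => by_contra fun hzU => h ⟨z, Set.mem_Ici.mp hz, hzU⟩)
      exact conv y x z (lt_of_le_of_ne hyx (fun h => hyU (h ▸ hx)))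
        (lt_of_le_of_ne hxz (fun h => hzU (h ▸ hx))) hyU hx hzU
    · rintro (hx | hx)
      · exact hDU hx
      · exact hVU hx
  have hDsup : ∀ d ∈ D, ∀ d' ∈ D, d ⊔ d' ∈ D := by
    intro d hd d' hd' y hy
    rw [Set.mem_Iic] at hy
    have h1 : Set.Iic (y ⊓ d) ⊆ U := fun t ht =>
      hd (Set.mem_Iic.mpr ((Set.mem_Iic.mp ht).trans inf_le_right))
    have h2 : Set.Iic (y ⊓ d') ⊆ U := fun t ht =>
      hd' (Set.mem_Iic.mpr ((Set.mem_Iic.mp ht).trans inf_le_right))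
    have := hsup _ _ h1 h2
    rwa [← inf_sup_left, inf_eq_left.mpr hy] at this
  have hVinf : ∀ v ∈ V, ∀ v' ∈ V, v ⊓ v' ∈ V := by
    intro v hv v' hv' y hy
    rw [Set.mem_Ici] at hy
    have h1 : Set.Ici (y ⊔ v) ⊆ U := fun t ht =>
      hv (Set.mem_Ici.mpr (le_sup_right.trans (Set.mem_Ici.mp ht)))
    have h2 : Set.Ici (y ⊔ v') ⊆ U := fun t ht =>
      hv' (Set.mem_Ici.mpr (le_sup_right.trans (Set.mem_Ici.mp ht)))
    have := hinf _ _ h1 h2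
    rwa [← sup_inf_left, sup_eq_left.mpr hy] at this
  have hDprin : D = ∅ ∨ ∃ a, D = Set.Iic a := by
    by_cases hDe : D = ∅
    · exact Or.inl hDe
    · right
      obtain ⟨x₀, hx₀⟩ := Set.nonempty_iff_ne_empty.mpr hDe
      have hne : (Finset.univ.filter (fun x => x ∈ D)).Nonempty := ⟨x₀, by simp [hx₀]⟩
      refine ⟨(Finset.univ.filter (fun x => x ∈ D)).sup' hne id, ?_⟩
      have hmem : (Finset.univ.filter (fun x => x ∈ D)).sup' hne id ∈ D :=
        Finset.sup'_mem D (fun x hx y hy => hDsup x hx y hy) _ hne id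
          (fun i hi => (Finset.mem_filter.mp hi).2)
      ext x
      constructor
      · intro hx
        exact Set.mem_Iic.mpr (Finset.le_sup' id (by simpa using hx))
      · intro hx
        exact hDdown _ hmem x (Set.mem_Iic.mp hx)
  have hVprin : V = ∅ ∨ ∃ b, V = Set.Ici b := by
    by_cases hVe : V = ∅
    · exact Or.inl hVe
    · right
      obtain ⟨x₀, hx₀⟩ := Set.nonempty_iff_ne_empty.mpr hVe
      have hne : (Finset.univ.filter (fun x => x ∈ V)).Nonempty := ⟨x₀, by simp [hx₀]⟩
      refine ⟨(Finset.univ.filter (fun x => x ∈ V)).inf' hne id, ?_⟩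
      have hmem : (Finset.univ.filter (fun x => x ∈ V)).inf' hne id ∈ V :=
        Finset.inf'_mem V (fun x hx y hy => hVinf x hx y hy) _ hne id
          (fun i hi => (Finset.mem_filter.mp hi).2)
      ext x
      constructor
      · intro hx
        exact Set.mem_Ici.mpr (Finset.inf'_le id (by simpa using hx))
      · intro hx
        exact hVup _ hmem x (Set.mem_Ici.mp hx)
  rcases hDprin with hD0 | ⟨a, ha⟩ <;> rcases hVprin with hV0 | ⟨b, hb⟩
  · left
    rw [hUDV, hD0, hV0, Set.empty_union]
  · right; right; left
    exact ⟨b, by rw [hUDV, hD0, hb, Set.empty_union]⟩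
  · right; left
    exact ⟨a, by rw [hUDV, ha, hV0, Set.union_empty]⟩
  · right; right; right
    refine ⟨a, b, ?_⟩
    rw [hUDV, ha, hb]
    ext x
    simp only [Set.mem_union, Set.mem_Iic, Set.mem_Ici, mem_boxUnion]

end Core

end Summit.Ventures.PercRepro2
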